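import Literature.Computability.MetaComplexity.OneSidedHeuristics
import Literature.Computability.MetaComplexity.SchemeEncBricks
import Literature.Computability.Complexity.LengthCompare
import HarnessLib

/-!
# Complexity meta: universal heuristic schemes for search problems (Hirahara 2021, Def. 8.8, Thm. 8.9, Cor. 8.12)

Topic `Literature/Computability/MetaComplexity`, companion to `UniversalHeuristicSchemes.lean` (Def. 6.2,
decision version) and `OneSidedHeuristics.lean` (`Avg¹_δ P` and the tally ensemble) for S. Hirahara,
*Average-case hardness of NP from exponential worst-case hardness assumptions*, STOC 2021, full
version ECCC TR21-058 (numbering cited). In §8.2 the paper constructs a universal heuristic scheme for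
the **search version** of `NP_sv` (Def. 8.8, Thm. 8.9) and obtains the decision version as a one-line
corollary (Cor. 8.12: "Since a decision problem reduces to its search version"). This file vendors
that step; Thm. 8.9 (for `UP`) is the **only** named fact of §8 in the tree — Cor. 8.12 (for `UP`) is
a theorem proved from it here, not a separate fact (D-0026: one published result, one debt entry):

* `UniversalMachine.IsSearchUHS R p S C` / `HasSearchUHS` — Def. 8.8 for an `NP`-type verifier given,
  as everywhere in the tree (`UP`, `IsPolyVerifierFor`), by a relation language `R` of pairs `⟨x, y⟩`
  and a witness-length polynomial `p` (`V(x, y) = 1 :↔ |y| ≤ p(|x|) ∧ ⟨x, y⟩ ∈ R`): polynomial-time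
  `S(x; 1ᵗ, 1ᵐ) ∈ {0,1}*`, `C(x; 1ᵗ, 1ᵏ) ∈ {0,1}` and a polynomial `q` with, for all `x`, `t ≥ q(|x|)`,
  `k`: (1) `cd^{t,q(t)}(x) ≤ k ⟹ C(x; 1ᵗ, 1ᵏ) = 1`; (2) `C(x; 1ᵗ, 1ᵏ) = 1` and `x` has a certificate
  `⟹ V(x, S(x; 1ᵗ, 1^{2^k})) = 1`;
* the named fact (D-0014) `Hirahara2021_UP_searchUHS_of_Avg1P` — **Thm. 8.9 for `UP`-type verifiers**:
  if `coNP × {U, T} ⊆ Avg¹_{1-n^{-c}} P` for some constant `c`, then every `UP`-type verifier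
  (`R ∈ P`, `p`, at most one certificate per input) admits a search universal heuristic scheme;
* PROVED: `IsSearchUHS.isUniversalHeuristicScheme` — **a search scheme for a verifier of `L` is a
  (decision) universal heuristic scheme for `L`** with the solver `x ↦ V(x, S(x; 1ᵗ, 1ᵐ))` (the
  content of Cor. 8.12's proof; no unambiguity needed), its machine lemma
  `polyTimeComputable_decide_verifier`, the non-vacuity lemma `isSearchUHS_nil`, and
  **`Hirahara2021_UP_hasUHS_of_Avg1P_of_search` : Thm. 8.9 (`UP` form) ⟹ Cor. 8.12 (`UP` form)** —
  *if `coNP × {U, T} ⊆ Avg¹_{1-n^{-c}} P` for some constant `c`, then every `L ∈ UP` admits a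
  universal heuristic scheme* (Cor. 8.12 specialised along Fact 8.4, `UP ⊆ NP_sv`), stated in full in
  its conclusion, so that the chain behind `hirahara_UP_DistNP` (Thm. 1.6 (1)) bottoms out in Thm. 8.9.

## Design choices

* Verifiers are `(R, p)` with `|y| ≤ p(|x|)`, the tree's format (`UP`, `NP = polyExists P`), whereas the
  paper's Def. 8.1/8.2 fix the certificate length to `t(|x|)` and ask `V` to run in time `O(t(n))` and
  (for `NP_sv`) the certificate-counting promise problem `Π_V` to lie in `pr-AMTIME(t(n))`. For a
  `UP`-type verifier the count is `≤ 1` and `Π_V` is trivial (proof of Fact 8.4), and fixing the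
  certificate length is a padding; a search scheme for the padded verifier is unpadded in polynomial
  time. Hence the fact below is Thm. 8.9 *restricted to `UP`-type verifiers and recoded*, a
  consequence of Thm. 8.9 with (the proof of) Fact 8.4 and weaker than Thm. 8.9; `NP_sv` itself is not
  vendored (see `OneSidedHeuristics.lean`).
* "`x ∈ L`" in Def. 8.8 (2) is rendered by the verifier itself, `∃ y, |y| ≤ p(|x|) ∧ ⟨x, y⟩ ∈ R`, so
  that no language needs to be named; `IsSearchUHS.isUniversalHeuristicScheme` takes the defining
  equivalence `x ∈ L ↔ ∃ y, …` (`IsPolyVerifierFor`) as a hypothesis.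
* Solver output encoding `id` (a string), checker output `encodeBool`, inputs `schemeEnc` as in Def. 6.2.

## References

* S. Hirahara, *Average-case hardness of NP from exponential worst-case hardness assumptions*, STOC 2021;
  full version ECCC TR21-058: Def. 8.1, Def. 8.2, Fact 8.4, Def. 8.8, Thm. 8.9, Claims 8.10–8.11,
  Cor. 8.12 (p. 40–42).
* S. Arora, B. Barak, *Computational Complexity: A Modern Approach*, CUP 2009, §2.5 (decision versus
  search), §1.3 (composition).
-/

namespace Literature.Computability.MetaComplexity

open _root_.Computability Complexity Complexity.Classes Complexity.Nondeterministic

namespace UniversalMachine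

variable (U : UniversalMachine)

/-! ### Def. 8.8: universal heuristic schemes for the search problem of a verifier -/

/-- `U.IsSearchUHS R p S C`: the pair `(S, C)` is a **universal heuristic scheme for the search
problem** of the `NP`-type verifier `(R, p)` (`V(x, y) = 1 :↔ |y| ≤ p(|x|) ∧ ⟨x, y⟩ ∈ R`): the solver
`S(x; 1ᵗ, 1ᵐ)` (string output) and the checker `C(x; 1ᵗ, 1ᵏ)` (Boolean) are polynomial-time on the
scheme encoding, and for some polynomial `q`, for every `x`, every `t ≥ q(|x|)` and every `k`:
(1) if `cd^{t,q(t)}(x) ≤ k` then `C(x; 1ᵗ, 1ᵏ) = 1`, and (2) if `C(x; 1ᵗ, 1ᵏ) = 1` and `x` has a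
certificate, then `S(x; 1ᵗ, 1^{2^k})` is a certificate of `x`.
[Hirahara 2021 (ECCC TR21-058), Def. 8.8] [cite: Hirahara2021, Def. 8.8] -/
structure IsSearchUHS (R : Language Bool) (p : Polynomial ℕ) (S : List Bool → ℕ → ℕ → List Bool)
    (C : List Bool → ℕ → ℕ → Bool) : Prop where
  /-- The solver runs in time polynomial in `|⟨x, ⟨1ᵗ, 1ᵐ⟩⟩|` and outputs a string. -/
  solver_polyTime : PolyTimeComputable schemeEnc (id : List Bool → List Bool)
    fun q : List Bool × ℕ × ℕ => S q.1 q.2.1 q.2.2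
  /-- The checker runs in time polynomial in `|⟨x, ⟨1ᵗ, 1ᵏ⟩⟩|`. -/
  checker_polyTime :
    PolyTimeComputable schemeEnc encodeBool fun q : List Bool × ℕ × ℕ => C q.1 q.2.1 q.2.2
  /-- Items (1) and (2) of Def. 8.8 for some polynomial `q`, all `x`, all `t ≥ q(|x|)`, all `k`. -/
  exists_polynomial : ∃ q : Polynomial ℕ, ∀ (x : List Bool) (t k : ℕ), q.eval x.length ≤ t →
    (U.cdAt t (q.eval t) x ≤ k → C x t k = true) ∧
    (C x t k = true → (∃ y : List Bool, y.length ≤ p.eval x.length ∧ boolPair x y ∈ R) →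
      (S x t (2 ^ k)).length ≤ p.eval x.length ∧ boolPair x (S x t (2 ^ k)) ∈ R)

/-- `U.HasSearchUHS R p`: the search problem of the verifier `(R, p)` admits a universal heuristic
scheme. [Hirahara 2021 (ECCC TR21-058), Def. 8.8] [cite: Hirahara2021, Def. 8.8] -/
def HasSearchUHS (R : Language Bool) (p : Polynomial ℕ) : Prop :=
  ∃ (S : List Bool → ℕ → ℕ → List Bool) (C : List Bool → ℕ → ℕ → Bool), U.IsSearchUHS R p S C

variable {U}

/-- A search scheme witnesses `HasSearchUHS`. [Hirahara 2021 (ECCC TR21-058), Def. 8.8]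
[cite: Hirahara2021, Def. 8.8] -/
theorem IsSearchUHS.hasSearchUHS {R : Language Bool} {p : Polynomial ℕ}
    {S : List Bool → ℕ → ℕ → List Bool} {C : List Bool → ℕ → ℕ → Bool}
    (h : U.IsSearchUHS R p S C) : U.HasSearchUHS R p :=
  ⟨S, C, h⟩

end UniversalMachine

/-! ### Decision reduces to search (the proof of Cor. 8.12) -/

/-- **The decision solver is polynomial-time.** If `S(x; 1ᵗ, 1ᵐ)` is a polynomial-time string-valued
algorithm on the scheme encoding and `R ∈ P`, then `(x; 1ᵗ, 1ᵐ) ↦ V(x, S(x; 1ᵗ, 1ᵐ))`, i.e.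
`[|S(…)| ≤ p(|x|)] ∧ [⟨x, S(…)⟩ ∈ R]`, is polynomial-time with Boolean output: run `S` as a total `FP`
function behind the normaliser (`polyTimeComputable_decScheme`), pair its output with `x` (`fanoutFn`,
`Brick.fstF`), and branch on the witness-length test `lenLeFn p` (`iteFn`) to the decider of `R`
(`mem_P_iff_holds`) or to the constant `0`. [Arora–Barak 2009, §1.3 and §2.5; Hirahara 2021
(ECCC TR21-058), proof of Cor. 8.12] [folklore] -/
theorem polyTimeComputable_decide_verifier {R : Language Bool} (hR : R ∈ P) (p : Polynomial ℕ)
    {S : List Bool → ℕ → ℕ → List Bool}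
    (hS : PolyTimeComputable schemeEnc (id : List Bool → List Bool)
      fun q : List Bool × ℕ × ℕ => S q.1 q.2.1 q.2.2) :
    PolyTimeComputable schemeEnc encodeBool fun q : List Bool × ℕ × ℕ =>
      decide ((S q.1 q.2.1 q.2.2).length ≤ p.eval q.1.length) &&
        R.boolIndicator (boolPair q.1 (S q.1 q.2.1 q.2.2)) := by
  -- the solver as a total `FP` function behind the normaliser
  have hSt : (fun w : List Bool => S (decScheme w).1 (decScheme w).2.1 (decScheme w).2.2) ∈ FP := by
    obtain ⟨r, M, hM⟩ := PolyTimeComputable.comp_holds hS polyTimeComputable_decScheme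
    exact ⟨r, M, fun w => hM w⟩
  -- the decider of `R` as a one-bit `FP` function
  have hdec : (fun z : List Bool => encodeBool (R.boolIndicator z)) ∈ FP := by
    obtain ⟨r, M, hM⟩ := polyTimeDecidable_iff.1 (mem_P_iff_holds.1 hR)
    exact ⟨r, M, fun z => hM z⟩
  set T : List Bool → List Bool :=
    iteFn (lenLeFn p) (fun z => encodeBool (R.boolIndicator z)) (fun _ => [false]) ∘
      fanoutFn Brick.fstF (fun w : List Bool => S (decScheme w).1 (decScheme w).2.1 (decScheme w).2.2)
    with hT
  have hTFP : T ∈ FP :=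
    comp_mem_FP (iteFn_mem_FP (lenLeFn_mem_FP p) hdec (const_mem_FP _))
      (fanoutFn_mem_FP Brick.fstF_mem_FP hSt)
  have hT_apply : ∀ q : List Bool × ℕ × ℕ, T (schemeEnc q) =
      encodeBool (decide ((S q.1 q.2.1 q.2.2).length ≤ p.eval q.1.length) &&
        R.boolIndicator (boolPair q.1 (S q.1 q.2.1 q.2.2))) := by
    rintro ⟨x, t, m⟩
    have hfst : Brick.fstF (schemeEnc (x, t, m)) = x := Brick.fstF_boolPair _ _
    simp only [hT, Function.comp_apply, fanoutFn_apply, decScheme_schemeEnc, hfst]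
    rw [iteFn_apply (lenLeFn_boolPair p x (S x t m))]
    by_cases hlen : (S x t m).length ≤ p.eval x.length
    · simp [hlen]
    · simp [hlen, encodeBool]
  obtain ⟨r, M, hM⟩ := hTFP
  refine ⟨r, M, fun q => ?_⟩
  have h := hM (schemeEnc q)
  rw [hT_apply] at h
  exact h

/-- **A decision problem reduces to its search version (proof of Cor. 8.12).** If `(S, C)` is a
universal heuristic scheme for the search problem of a verifier `(R, p)` with `R ∈ P`, and `L` is the
language verified by `(R, p)` (`x ∈ L ↔ ∃ y, |y| ≤ p(|x|) ∧ ⟨x, y⟩ ∈ R`), then the decision solver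
`S'(x; 1ᵗ, 1ᵐ) := V(x, S(x; 1ᵗ, 1ᵐ))` together with the same checker `C` is a universal heuristic
scheme for `L` (Def. 6.2), with the same polynomial: item (1) is unchanged; for item (2), if
`C(x; 1ᵗ, 1ᵏ) = 1` and `x ∈ L` then `S` returns a certificate and `S' = 1 = L(x)`, while for `x ∉ L`
no string is accepted by `V`, so `S' = 0 = L(x)`. Unambiguity is not used.
[Hirahara 2021 (ECCC TR21-058), Cor. 8.12 (proof: "Since a decision problem reduces to its search
version"); Arora–Barak 2009, §2.5] [cite: Hirahara2021, Cor. 8.12] -/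
theorem UniversalMachine.IsSearchUHS.isUniversalHeuristicScheme {U : UniversalMachine}
    {R : Language Bool} {p : Polynomial ℕ} {S : List Bool → ℕ → ℕ → List Bool}
    {C : List Bool → ℕ → ℕ → Bool} (hR : R ∈ P) (h : U.IsSearchUHS R p S C) {L : Language Bool}
    (hL : ∀ x : List Bool, x ∈ L ↔ ∃ y : List Bool, y.length ≤ p.eval x.length ∧ boolPair x y ∈ R) :
    U.IsUniversalHeuristicScheme L
      (fun x t m => decide ((S x t m).length ≤ p.eval x.length) && R.boolIndicator (boolPair x (S x t m)))
      C where
  solver_polyTime := polyTimeComputable_decide_verifier hR p h.solver_polyTime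
  checker_polyTime := h.checker_polyTime
  exists_polynomial := by
    obtain ⟨q, hq⟩ := h.exists_polynomial
    refine ⟨q, fun x t k ht => ⟨(hq x t k ht).1, fun hC => ?_⟩⟩
    by_cases hx : x ∈ L
    · obtain ⟨hlen, hmem⟩ := (hq x t k ht).2 hC ((hL x).1 hx)
      rw [(Set.mem_iff_boolIndicator _ _).1 hx, (Set.mem_iff_boolIndicator _ _).1 hmem,
        decide_eq_true hlen]
      rfl
    · rw [(Set.notMem_iff_boolIndicator _ _).1 hx, Bool.and_eq_false_iff]
      by_contra hne
      push Not at hne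
      obtain ⟨hlen, hmem⟩ := hne
      simp only [ne_eq, Bool.not_eq_false, decide_eq_true_eq] at hlen hmem
      exact hx ((hL x).2 ⟨_, hlen, (Set.mem_iff_boolIndicator _ _).2 hmem⟩)

/-- **Non-vacuity of Def. 8.8.** If the empty string certifies every input that has a certificate,
then the constant solver `S ≡ ε` with the always-accepting checker is a search universal heuristic
scheme (any polynomial `q`; e.g. for `R = {0,1}*`). [Hirahara 2021 (ECCC TR21-058), Def. 8.8]
[cite: Hirahara2021, Def. 8.8] -/
theorem UniversalMachine.isSearchUHS_nil (U : UniversalMachine) {R : Language Bool} {p : Polynomial ℕ}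
    (h : ∀ x : List Bool, (∃ y : List Bool, y.length ≤ p.eval x.length ∧ boolPair x y ∈ R) →
      boolPair x [] ∈ R) :
    U.IsSearchUHS R p (fun _ _ _ => []) (fun _ _ _ => true) where
  solver_polyTime := by
    obtain ⟨r, M, hM⟩ := const_mem_FP ([] : List Bool)
    exact ⟨r, M, fun q => hM (schemeEnc q)⟩
  checker_polyTime := polyTimeComputable_schemeEnc_const_true
  exists_polynomial := ⟨0, fun x _ _ _ => ⟨fun _ => rfl, fun _ hx => ⟨Nat.zero_le _, h x hx⟩⟩⟩

/-! ### Thm. 8.9 for `UP`-type verifiers (the named fact) and Cor. 8.12 for `UP` (proved from it) -/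

/-- **Hirahara 2021, Thm. 8.9, for `UP`-type verifiers.** *If `coNP × {U, T} ⊆ Avg¹_{1-n^{-c}} P`
for some constant `c`, then the search version of `NP_sv` admits a universal heuristic scheme*
(Def. 8.8: for every `L ∈ NP_sv` and every `NP_sv`-type verifier `V` for `L` there is a search scheme
`(S, C)`); vendored for the `UP`-type verifiers of the tree — `R ∈ P`, a witness-length polynomial
`p`, and at most one certificate `y` (`|y| ≤ p(|x|)`, `⟨x, y⟩ ∈ R`) per input —, which are
`NP_sv`-type verifiers up to fixing the certificate length by padding, with trivial counting promise
problem (proof of Fact 8.4: `UP ⊆ FewP ⊆ NP_sv`). Printed proof: Lemma 8.5 (hashing; trivial for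
`UP`), the language ensemble `L'` of `DP_k`-encoded certificates, Thm. 4.2 (algorithmic language
compression), Lemma 5.1 and Fact 3.8 (`Gap MINKT`), the pseudorandom generator of Lemma 3.4, Thm. 3.12
(reconstruction for `DP_k`) and Thm. 5.2 (weak symmetry of information), Claims 8.10–8.11. This fact
is a consequence of Thm. 8.9 and Fact 8.4 and is weaker than Thm. 8.9 (`NP_sv` is not vendored).
Conventions (as in `Hirahara2021_hasUHS_of_mem_UP`, `UniversalHeuristicSchemes.lean`):
`∀ U : UniversalMachine`; `coNP × {U, T}` is `distClass coNP {uniformEnsemble, tallyEnsemble}`;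
`Avg¹_{1-n^{-c}} P` is `Avg1DeltaP fun n => 1 - 1 / (n : ℝ) ^ c` (success probability `≥ n^{-c}`,
p. 9; `OneSidedHeuristics.lean`). The formalised proof of Thm. 8.9 relative to its §3–§5 ingredients
is `Hirahara2021_UP_searchUHS_of_Avg1P_of` (`UPSearchAssembly.lean`).
[Hirahara 2021 (ECCC TR21-058), Thm. 8.9 with Def. 8.8 and Fact 8.4]
[cite: Hirahara2021, Thm. 8.9 and Fact 8.4] -/
def Hirahara2021_UP_searchUHS_of_Avg1P : Prop :=
  ∀ U : UniversalMachine,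
    (∃ c : ℕ, distClass coNP {uniformEnsemble, tallyEnsemble} ⊆
      Avg1DeltaP fun n => 1 - 1 / (n : ℝ) ^ c) →
    ∀ (R : Language Bool) (p : Polynomial ℕ), R ∈ P →
      (∀ x : List Bool,
        {y : List Bool | y.length ≤ p.eval x.length ∧ boolPair x y ∈ R}.Subsingleton) →
      U.HasSearchUHS R p

/-- **Hirahara 2021, Cor. 8.12, specialised along Fact 8.4 to `UP` — proved from Thm. 8.9 (for
`UP`-type verifiers).** *If `coNP × {U, T} ⊆ Avg¹_{1-n^{-c}} P` for some constant `c`, then every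
language `L ∈ UP` admits a universal heuristic scheme* (w.r.t. every efficient universal machine `U`).
Printed: Cor. 8.12 — "If `coNP × {U, T} ⊆ Avg¹_{1-n^{-c}} P` for some constant `c`, then every
`L ∈ NP_sv` admits a universal heuristic scheme", proof: "Since a decision problem reduces to its
search version" (from Thm. 8.9); Fact 8.4 — "`UP ⊆ FewP ⊆ NP_sv ⊆ NP`"; p. 51 — "Since `UP ⊆ NP_sv`,
Item 1 of Theorem 1.6 is a special case of Theorem 11.1." The class `NP_sv` (Def. 8.2) is not
vendored, so the conclusion is the printed corollary restricted to `UP`, weaker than Cor. 8.12.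
Proof, given the named fact `Hirahara2021_UP_searchUHS_of_Avg1P` (Thm. 8.9 for `UP`-type verifiers):
a language `L ∈ UP` comes with a `UP`-type verifier `(R, p)`; its search scheme is turned into a
decision scheme by `IsSearchUHS.isUniversalHeuristicScheme`. (This corollary is deliberately a
theorem with the Thm-8.9 hypothesis and not a named fact of its own: it is the same published result
in decision form.) Conventions: `coNP × {U, T}` is `distClass coNP {uniformEnsemble, tallyEnsemble}`;
`Avg¹_{1-n^{-c}} P` is `Avg1DeltaP fun n => 1 - 1 / (n : ℝ) ^ c`; `UP`, `HasUniversalHeuristicScheme`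
(Def. 6.2) as in `UniversalHeuristicSchemes.lean`.
[Hirahara 2021 (ECCC TR21-058), Cor. 8.12 with Fact 8.4; Thm. 8.9; remark after Thm. 11.1 (p. 51)]
[cite: Hirahara2021, Cor. 8.12 and Fact 8.4] -/
theorem Hirahara2021_UP_hasUHS_of_Avg1P_of_search (h : Hirahara2021_UP_searchUHS_of_Avg1P) :
    ∀ U : UniversalMachine,
      (∃ c : ℕ, distClass coNP {uniformEnsemble, tallyEnsemble} ⊆
        Avg1DeltaP fun n => 1 - 1 / (n : ℝ) ^ c) →
      ∀ L ∈ UP, U.HasUniversalHeuristicScheme L := by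
  intro U hhyp L hL
  obtain ⟨R, hR, p, hver, hsub⟩ := hL
  obtain ⟨S, C, hSC⟩ := h U hhyp R p hR hsub
  exact (hSC.isUniversalHeuristicScheme hR hver).hasUniversalHeuristicScheme

end Literature.Computability.MetaComplexity
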